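/-
Copyright (c) 2026 the pub-hodgecm-mathlib formalisation cell (harness21).  Prover seat hodgecm-mathlib-K2Liu-p10 (g2), Track B «K2-LIT»,
#184♮ = hLiu418 = `stmt-HodgeConjecture-24832`; LEAD F0P6-plan (g12) RULING «M-156n» (1) 2026-09-04T08:09:40Z «Φ9-CORE = GO NOW», ROAD Φ's END
(the assembly of socket #41 `sig_K2LiuSiegelEisensteinContinuation` on `{0 < re s}`); consumer sheet `K2/K2Liu-p10/g2/CENSUS-Phi9-Assembly.K2Liu-p10-g2.md`
1c38e55b2c057f5d.  THEOREMS ONLY (no `def`, no `instance`, no named-fact hypothesis, no `sorry`); file 1∕2 (abstract core).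
-/
import Summits.HodgeConjecture.HodgeConjecture.Theorems.K2E1EisensteinSeriesRegularity
import Mathlib.Analysis.Complex.CauchyIntegral
import Mathlib.Analysis.Complex.Convex
import Mathlib.Analysis.Convex.PathConnected
import Mathlib.Analysis.SpecialFunctions.Pow.Real
import HarnessLib

/-!
# Crux `HLiu418`, ROAD Φ, organ Φ9 (CORE, abstract): TERM PACKAGES + ONE LOCALLY UNIFORM SUMMABLE MAJORANT ⇒ the five clauses of #41

Cell `hodgecm-mathlib`, crux item hLiu418 = `stmt-HodgeConjecture-24832` (helper lane, count-neutral).  Socket #41 asks for a CONTINUATION PACKAGE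
`(P, Es)` of `s ↦ E(h; f_s)` on `{0 < re s}`: (A1) holomorphy in `s` for each `h`, (A2) continuity in `h`, (A3) left `H(L⁺)`-invariance, (A4)
`Es = (∏_{p∈P}(s−p))·E` on the convergence half-plane `{n∕2 < re s}`, (A5) locally-uniform-in-`s` moderate growth `‖Es s h‖ ≤ C‖h‖^A` — the currency of
★ `K2LiuContinuationPackageAlgebra`.  ROAD Φ builds `Es` as the FOURIER SERIES `Σ'_S E⋆_S(s)(h)` of the continued, pole-cleared coefficients.  This file is
the assembly step in ABSTRACT form (any index type `ι`, any topological space `X` in place of `H(𝔸)`, any height `X → ℝ`, any family of symmetries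
`σ : J → X → X`, abscissae `a ≤ c`): GIVEN
* TERM PACKAGES `Ec : ι → ℂ → X → ℂ` — each term holomorphic on `{a < re}` in `s` (`hd`) and continuous in `x` (`hc`);
* AGREEMENT `heq`: on `{c < re}`, `HasSum (i ↦ Ec i s x) ((∏_{p∈P}(s−p)) · E s x)` (the Fourier expansion ★ Φ1 of the pole-cleared series, termwise ★ Φ2∕Φ7);
* ONE LOCALLY UNIFORM SUMMABLE MAJORANT `hmaj`: for `a < re z` and `x₀` there are `r > 0`, `V ∈ 𝓝 x₀`, summable `m` with `‖Ec i s x‖ ≤ m i` for `dist s z < r`, `x ∈ V`;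
* the SUMMED GROWTH `hgrowth`: `Σ'_i ‖Ec i s x‖ ≤ C · height x ^ A` for `dist s z < r`, all `x` (organ G7: Iwasawa-vs-height);
* the symmetries of the convergent series `hE : E s (σ j x) = E s x` on `{c < re}` (★ #10b),
THEN `Es s x := Σ'_i Ec i s x` satisfies (A1) `differentiableOn_tsum_package` (★ `K2E1EisensteinSeriesRegularity.differentiableOn_tsum_param`), (A2)
`continuous_tsum_package` (★ `continuous_tsum_of_locallyUniformMajorant`), (A4) `tsum_package_eq` (`HasSum.tsum_eq`), (A3) `tsum_package_invariant` — the IDENTITY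
PRINCIPLE pointwise in `x` on the connected half-plane `{a < re}` (Mathlib `AnalyticOnNhd.eqOn_of_preconnected_of_eventuallyEq`, shape of ★ O41.9
`eqOn_of_eqOn_halfPlane`), (A5) `norm_tsum_package_le` (the ball shrunk into `{a < re}`, `‖Σ'‖ ≤ Σ'‖·‖`), packaged as **`exists_package_of_term_packages`**.
File 2∕2 `K2LiuSiegelEisensteinAssembly` instantiates `X := H(𝔸)`, `height := adelicHeightGL`, `σ γ h := γ·h` (`γ ∈ H(L⁺)`), `E := eisensteinFamilyDelta f`, `a := 0`,
`c := n∕2` — the conclusion of #41 :289 VERBATIM.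
Sources: [MoeglinWaldspurger1995, II.1.5, IV.1.8–IV.1.11]; [Tan1999, §1, §4 Prop. 4.8]; [Garrett2018, §2.8].
HONEST LABEL.  Helper lemmas, count-neutral; `HC_CM` is proved only modulo the 7 printed citations (2 remaining named inputs:
hLiu418 = `stmt-HodgeConjecture-24832`, h413 = `stmt-HodgeConjecture-24833`) until rung 0 closes.
-/

set_option autoImplicit false
set_option linter.dupNamespace false -- the mandated namespace repeats `HodgeConjecture.HodgeConjecture`

noncomputable section

namespace Summit.HodgeConjecture.HodgeConjecture.Cruxes.HLiu418.K2LiuSiegelEisensteinAssemblyCore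

open Set Filter Topology Metric Complex
open scoped BigOperators
open Summit.HodgeConjecture.HodgeConjecture.Cruxes.H413.K2E1EisensteinSeriesRegularity

variable {X : Type*} [TopologicalSpace X] {ι : Type*} {J : Type*}
  (a c : ℝ) (E : ℂ → X → ℂ) (P : Finset ℂ) (Ec : ι → ℂ → X → ℂ)
  (hd : ∀ i x, DifferentiableOn ℂ (fun s => Ec i s x) {s : ℂ | a < s.re})
  (hc : ∀ i s, a < s.re → Continuous (Ec i s))
  (heq : ∀ s x, c < s.re → HasSum (fun i => Ec i s x) ((∏ p ∈ P, (s - p)) * E s x))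
  (hmaj : ∀ z : ℂ, a < z.re → ∀ x₀ : X, ∃ r > (0 : ℝ), ∃ V ∈ 𝓝 x₀, ∃ m : ι → ℝ, Summable m ∧
    ∀ s : ℂ, dist s z < r → ∀ x ∈ V, ∀ i, ‖Ec i s x‖ ≤ m i)
  (height : X → ℝ)
  (hgrowth : ∀ z : ℂ, a < z.re → ∃ C A r : ℝ, 0 < r ∧ ∀ s : ℂ, dist s z < r → ∀ x, ∑' i, ‖Ec i s x‖ ≤ C * height x ^ A)
  (σ : J → X → X) (hE : ∀ j s x, c < s.re → E s (σ j x) = E s x)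

/-! ## 1. Holomorphy, continuity, agreement -/

omit [TopologicalSpace X] in
/-- The half-plane `{a < re}` is open. [folklore] -/
theorem isOpen_halfPlane : IsOpen {s : ℂ | a < s.re} := isOpen_lt continuous_const Complex.continuous_re

include hmaj in
/-- Each point of `{a < re} × X` has the summable majorant of `hmaj` at itself: the terms are absolutely summable. [folklore] -/
theorem summable_norm_term {s : ℂ} (hs : a < s.re) (x : X) : Summable fun i => ‖Ec i s x‖ := by
  obtain ⟨r, hr, V, hV, m, hm, hle⟩ := hmaj s hs x
  exact Summable.of_nonneg_of_le (fun _ => norm_nonneg _) (fun i => hle s (by rw [dist_self]; exact hr) x (mem_of_mem_nhds hV) i) hm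

include hd hmaj in
/-- **(A1) HOLOMORPHY**: `s ↦ Σ'_i Ec i s x` is holomorphic on `{a < re}` for every `x` (★ `differentiableOn_tsum_param`). [cite: MoeglinWaldspurger1995, II.1.5] -/
theorem differentiableOn_tsum_package (x : X) : DifferentiableOn ℂ (fun s => ∑' i, Ec i s x) {s : ℂ | a < s.re} := by
  refine differentiableOn_tsum_param (F := Ec) (isOpen_halfPlane a) x (fun i => hd i x) fun z hz => ?_
  obtain ⟨r, hr, V, hV, m, hm, hle⟩ := hmaj z hz x
  exact ⟨ball z r, ball_mem_nhds z hr, m, hm, fun s hs i => hle s (mem_ball.1 hs) x (mem_of_mem_nhds hV) i⟩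

include hc hmaj in
/-- **(A2) CONTINUITY IN `x`** at every `s` with `a < re s` (★ `continuous_tsum_of_locallyUniformMajorant`). [cite: MoeglinWaldspurger1995, II.1.5] -/
theorem continuous_tsum_package {s : ℂ} (hs : a < s.re) : Continuous fun x => ∑' i, Ec i s x := by
  refine continuous_tsum_of_locallyUniformMajorant (F := fun i x => Ec i s x) (fun i => hc i s hs) fun x₀ => ?_
  obtain ⟨r, hr, V, hV, m, hm, hle⟩ := hmaj s hs x₀
  exact ⟨V, hV, m, hm, fun x hx i => hle s (by rw [dist_self]; exact hr) x hx i⟩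

omit [TopologicalSpace X] in
include heq in
/-- **(A4) AGREEMENT** on the convergence half-plane: `Σ'_i Ec i s x = (∏_{p∈P}(s−p))·E s x` for `c < re s`. [cite: Tan1999, §1] -/
theorem tsum_package_eq {s : ℂ} (hs : c < s.re) (x : X) : ∑' i, Ec i s x = (∏ p ∈ P, (s - p)) * E s x :=
  (heq s x hs).tsum_eq

/-! ## 2. Symmetries by the identity principle -/

include hd heq hmaj hE in
/-- **(A3) INVARIANCE for every `s` with `a < re s`**: `Σ'_i Ec i s (σ j x) = Σ'_i Ec i s x` — both sides are holomorphic on the CONNECTED half-plane `{a < re}`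
and agree on its non-empty open part `{c < re}` (`a ≤ c`), where they are `(∏(s−p))·E s (σ j x) = (∏(s−p))·E s x` by `hE`.
[cite: MoeglinWaldspurger1995, IV.1.8] [cite: Tan1999, §1] -/
theorem tsum_package_invariant (hac : a ≤ c) (j : J) {s : ℂ} (hs : a < s.re) (x : X) :
    ∑' i, Ec i s (σ j x) = ∑' i, Ec i s x := by
  have hU : IsOpen {s : ℂ | a < s.re} := isOpen_halfPlane a
  have h₁ := (differentiableOn_tsum_package a Ec hd hmaj (σ j x)).analyticOnNhd hU
  have h₂ := (differentiableOn_tsum_package a Ec hd hmaj x).analyticOnNhd hU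
  -- a point of `{c < re}` and agreement near it
  set z₀ : ℂ := ((max a c + 1 : ℝ) : ℂ) with hz₀
  have hz₀c : c < z₀.re := by rw [hz₀, Complex.ofReal_re]; linarith [le_max_right a c]
  have hz₀a : z₀ ∈ {s : ℂ | a < s.re} := lt_of_le_of_lt hac hz₀c
  have hev : (fun s => ∑' i, Ec i s (σ j x)) =ᶠ[𝓝 z₀] fun s => ∑' i, Ec i s x := by
    filter_upwards [(isOpen_lt continuous_const Complex.continuous_re).mem_nhds hz₀c] with s hs
    rw [tsum_package_eq c E P Ec heq hs, tsum_package_eq c E P Ec heq hs, hE j s x hs]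
  exact h₁.eqOn_of_preconnected_of_eventuallyEq h₂ (convex_halfSpace_re_gt a).isPreconnected hz₀a hev hs

/-! ## 3. Growth -/

include hmaj hgrowth in
/-- **(A5) LOCALLY UNIFORM MODERATE GROWTH**: near every `z` with `a < re z` (on a ball INSIDE `{a < re}`), `‖Σ'_i Ec i s x‖ ≤ C · height x ^ A` for all `x`.
[cite: MoeglinWaldspurger1995, II.1.5, IV.1.9] -/
theorem norm_tsum_package_le {z : ℂ} (hz : a < z.re) :
    ∃ C A r : ℝ, 0 < r ∧ ∀ s : ℂ, dist s z < r → ∀ x, ‖∑' i, Ec i s x‖ ≤ C * height x ^ A := by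
  obtain ⟨C, A, r, hr, hle⟩ := hgrowth z hz
  refine ⟨C, A, min r (z.re - a), lt_min hr (sub_pos.2 hz), fun s hs x => ?_⟩
  have hsr : dist s z < r := lt_of_lt_of_le hs (min_le_left _ _)
  have hsa : a < s.re := by
    have h1 : |s.re - z.re| ≤ dist s z := by
      rw [Complex.dist_eq]
      simpa using Complex.abs_re_le_norm (s - z)
    have h2 : dist s z < z.re - a := lt_of_lt_of_le hs (min_le_right _ _)
    have h3 : -(z.re - a) < s.re - z.re := (abs_lt.1 (lt_of_le_of_lt h1 h2)).1
    linarith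
  exact (norm_tsum_le_tsum_norm (summable_norm_term a Ec hmaj hsa x)).trans (hle s hsr x)

/-! ## 4. The package -/

include hd hc heq hmaj hgrowth hE in
/-- **Φ9-CORE: TERM PACKAGES + ONE LOCALLY UNIFORM SUMMABLE MAJORANT ⇒ A CONTINUATION PACKAGE** — the five clauses (A1)–(A5) of socket #41 in abstract
currency, for `Es s x := Σ'_i Ec i s x`. [cite: MoeglinWaldspurger1995, II.1.5, IV.1.8–IV.1.11] [cite: Tan1999, §1, §4 Prop. 4.8] -/
theorem exists_package_of_term_packages (hac : a ≤ c) :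
    ∃ Es : ℂ → X → ℂ,
      (∀ x, DifferentiableOn ℂ (fun s => Es s x) {s : ℂ | a < s.re}) ∧
      (∀ s : ℂ, a < s.re → Continuous (Es s)) ∧
      (∀ s : ℂ, a < s.re → ∀ (j : J) (x : X), Es s (σ j x) = Es s x) ∧
      (∀ (s : ℂ) (x : X), c < s.re → Es s x = (∏ p ∈ P, (s - p)) * E s x) ∧
      (∀ z : ℂ, a < z.re → ∃ C A r : ℝ, 0 < r ∧ ∀ s : ℂ, dist s z < r → ∀ x, ‖Es s x‖ ≤ C * height x ^ A) :=
  ⟨fun s x => ∑' i, Ec i s x, differentiableOn_tsum_package a Ec hd hmaj, fun _ hs => continuous_tsum_package a Ec hc hmaj hs,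
    fun _ hs j x => tsum_package_invariant a c E P Ec hd heq hmaj σ hE hac j hs x, fun _ x hs => tsum_package_eq c E P Ec heq hs x,
    fun _ hz => norm_tsum_package_le a Ec hmaj height hgrowth hz⟩

end Summit.HodgeConjecture.HodgeConjecture.Cruxes.HLiu418.K2LiuSiegelEisensteinAssemblyCore

end
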